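import Summits.QuantumAdvantage.AdviceFreeQNC0.Transport
import Summits.QuantumAdvantage.AdviceFreeQNC0.SymmetricOptima
import HarnessLib

/-!
# Cell qa-qnc0 (rung F-Q1, density axis): the transport conjecture at m = 15 is FALSE —
# `¬ TransportAll 15 (symWord 15 false)`, hence `¬ TransportFifteen` (planner qa-qnc0-p1 g14, ask P21(a))

Planner qa-qnc0-p1 (ROUND-13 §2.14, `HOME/qa-qnc0-p1/Sketch16.lean`, STATUS 2026-08-27T16:30Z/16:47Z) found that
the UNREDUCED transport statement `(★-T⁺)(15)` = `MassInequality.TransportAll 15 K0` fails at the optimum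
`K0 = SymCount.symWord 15 false` of `C_15` (zeros `Z` = weights `4, 5, 10, 11`; `|Z| = 8736`), and typed the prover
item `NotTransportAllSym15`.  This file lands it, by the planner's FULLY EXPLICIT certificate:

* the outside set `E = {u : u 0 = false ∧ (wt u ∈ {1, 7, 13} ∨ (wt u = 9 ∧ u 1 = false))}`, `|E| = 4175`
  (`2|E| = 8350 ≤ 8736 = |Z|`, so `TransportAll` must supply a transport `n : Z → [0,1]` of mass `≤ |E|`);
* the three codewords `W0′ = (T₀ = 0, T₁ = T₂ = [wt u odd])`, `W1′ = (T₀ = T₁ = [u 0 = false], T₂ = 0)`,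
  `W2′ = (T₀ = T₁ = [u 1 ⊕ ⋯ ⊕ u 14 = true], T₂ = 0)` (`TransportRefute.Y0/Y1/Y2`, each a `SymCount.cwOf`, hence in
  `C_15` by `SymCount.isElim1_cwOf`), whose transport demands `2|E ∩ Y ∩ Out| − (outCount − inCount)` are
  `2·3460 − (6555 − 4368) = 4733`, `2·4175 − (8921 − 2002) = 1431`, `2·4175 − (8192 − 2366) = 2524` on the
  pairwise DISJOINT zero-parts `Z₂`, `Z₁ ∩ {u 0 = false}`, `Z₁ ∩ {u 0 = true}`; total `8688 > 8350 = 2|E| ≥ 2·Σ n`.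

All eleven counts are evaluated by the orbit-counting engine of `SymmetricCount.lean` with the master blocks
`S0 = {0}`, `S1 = {1}` (`SymCount.card_filter_eq_sum_box4` + `sum_box4_eq_G4`: 56-term binomial sums `G4r 0 1 1 13`,
decided by the kernel); `|Z| = 8736` is `SymCount.failCount_symWord_fifteen`.

* `notTransportAllSym15 : ¬ TransportAll 15 (symWord 15 false)` (Sketch16 `NotTransportAllSym15`, verbatim);
* `notTransportFifteen : ¬ TransportFifteen` — the conjecture of record of `Transport.lean` (p540447) is refuted
  outright (the kernel knows `isOpt1_symWord_fifteen`, `isSymPat_symWord`).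

WHAT THIS IS NOT: the REDUCED statement `TransportCert 15 (symWord 15 false)` (Sketch16 P21(b), also claimed false
by the planner) is not treated here; `StarCert 15` / ONE-WORD MI(15) stay OPEN; separation NOT moved.
-/

namespace Summit.QuantumAdvantage.AdviceFreeQNC0

open Finset MassInequality SymCount

namespace TransportRefute

/-! ### Master blocks `S0 = {0}`, `S1 = {1}` and the predicates as functions of the four block weights -/

/-- Master coordinate set `{0}`. -/
def S0 : Finset (Fin 15) := {0}
/-- Master coordinate set `{1}`. -/
def S1 : Finset (Fin 15) := {1}
/-- The coordinates `1, …, 14`. -/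
def T : Finset (Fin 15) := univ.erase 0

/-- Total weight from block weights. -/
def W (k : ℕ × ℕ × ℕ × ℕ) : ℕ := k.1 + k.2.1 + k.2.2.1 + k.2.2.2
/-- Parity of the `S0`-weight (`= u 0` at realizable block weights). -/
def B0 (k : ℕ × ℕ × ℕ × ℕ) : Bool := par (k.1 + k.2.1)
/-- Parity of the `S1`-weight (`= u 1`). -/
def B1 (k : ℕ × ℕ × ℕ × ℕ) : Bool := par (k.1 + k.2.2.1)
/-- `K0 = symWord 15 false` (the OUTSIDE indicator) through block weights. -/
def φK (k : ℕ × ℕ × ℕ × ℕ) : Bool := sel (W k % 3) true (par (W k))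
/-- The certificate's outside set `E` through block weights. -/
def φE (k : ℕ × ℕ × ℕ × ℕ) : Bool :=
  !B0 k && (Nat.beq (W k) 1 || Nat.beq (W k) 7 || Nat.beq (W k) 13 || (Nat.beq (W k) 9 && !B1 k))
/-- `W0′` through block weights. -/
def φY0 (k : ℕ × ℕ × ℕ × ℕ) : Bool := sel (W k % 3) false (par (W k))
/-- `W1′` through block weights. -/
def φY1 (k : ℕ × ℕ × ℕ × ℕ) : Bool := sel (W k % 3) (xor true (par (k.1 + k.2.1))) (xor true (par (k.1 + k.2.1)))
/-- `W2′` through block weights. -/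
def φY2 (k : ℕ × ℕ × ℕ × ℕ) : Bool :=
  sel (W k % 3) (par (W k - (k.1 + k.2.1))) (par (W k - (k.1 + k.2.1)))

/-- **The outside set of the certificate**: `E u ⟺ u 0 = false ∧ (wt u ∈ {1,7,13} ∨ (wt u = 9 ∧ u 1 = false))`. -/
def E (u : Fin 15 → Bool) : Bool := φE (bw4 S0 S1 u)
/-- `W0′ = (0, parity, parity)`. -/
def Y0 : (Fin 15 → Bool) → Bool := cwOf ((∅ : Finset (Fin 15)), false) ((univ : Finset (Fin 15)), false)
/-- `W1′ = ([u 0 = false], [u 0 = false], 0)`. -/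
def Y1 : (Fin 15 → Bool) → Bool := cwOf (S0, true) (S0, true)
/-- `W2′ = ([u 1 ⊕ ⋯ ⊕ u 14], [u 1 ⊕ ⋯ ⊕ u 14], 0)`. -/
def Y2 : (Fin 15 → Bool) → Bool := cwOf (T, false) (T, false)

/-! ### Pointwise: every predicate is a function of the master block weights -/

/-- `par 0 = false`. -/
theorem par_zero : par 0 = false := rfl

/-- `K0 = symWord 15 false` reads through the master block weights. -/
theorem K0_eq (u : Fin 15 → Bool) : symWord 15 false u = φK (bw4 S0 S1 u) := by
  rw [symWord_apply, wt_eq_bw_sum S0 S1 u, Bool.false_xor]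
  rfl

/-- `W0′` reads through the master block weights. -/
theorem Y0_eq (u : Fin 15 → Bool) : Y0 u = φY0 (bw4 S0 S1 u) := by
  unfold Y0 cwOf tripleOf
  rw [affEval_eq_par, affEval_eq_par]
  simp only [Finset.filter_empty, Finset.card_empty, Bool.false_xor, par_zero]
  rw [show (univ.filter fun i : Fin 15 => u i = true).card = wt u from rfl, wt_eq_bw_sum S0 S1 u]
  rfl

/-- `W1′` reads through the master block weights. -/
theorem Y1_eq (u : Fin 15 → Bool) : Y1 u = φY1 (bw4 S0 S1 u) := by
  unfold Y1 cwOf tripleOf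
  rw [affEval_eq_par]
  simp only
  rw [card_filter_S0 S0 S1 u, wt_eq_bw_sum S0 S1 u]
  rfl

/-- `|u ∩ {1,…,14}| = wt u − [u 0]`. -/
theorem card_T (u : Fin 15 → Bool) :
    (T.filter fun i => u i = true).card = wt u - (S0.filter fun i => u i = true).card := by
  unfold T wt S0
  rw [Finset.filter_erase, Finset.card_erase_eq_ite, Finset.filter_singleton]
  by_cases h : u 0 = true
  · simp [h]
  · simp [h]

/-- `W2′` reads through the master block weights. -/
theorem Y2_eq (u : Fin 15 → Bool) : Y2 u = φY2 (bw4 S0 S1 u) := by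
  unfold Y2 cwOf tripleOf
  rw [affEval_eq_par]
  simp only
  rw [card_T, card_filter_S0 S0 S1 u, wt_eq_bw_sum S0 S1 u, Bool.false_xor]
  rfl

/-- `E ⊆ Out(K0)`. -/
theorem φK_of_φE (k : ℕ × ℕ × ℕ × ℕ) (h : φE k = true) : φK k = true := by
  unfold φE at h
  unfold φK
  simp only [Bool.and_eq_true, Bool.or_eq_true] at h
  obtain ⟨_, h⟩ := h
  rcases h with ((h | h) | h) | ⟨h, _⟩ <;> rw [Nat.eq_of_beq_eq_true h] <;> rfl

/-- `E ⊆ Out(K0)` pointwise. -/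
theorem E_subset (u : Fin 15 → Bool) (hu : E u = true) : symWord 15 false u = true := by
  rw [K0_eq]
  exact φK_of_φE _ hu

/-! ### Counting with the engine -/

/-- Block `(true,true)` of `({0},{1})` is empty. -/
theorem bs_tt : bs S0 S1 (true, true) = 0 := by unfold bs block lab S0 S1; decide
/-- Block `(true,false)` of `({0},{1})` is `{0}`. -/
theorem bs_tf : bs S0 S1 (true, false) = 1 := by unfold bs block lab S0 S1; decide
/-- Block `(false,true)` of `({0},{1})` is `{1}`. -/
theorem bs_ft : bs S0 S1 (false, true) = 1 := by unfold bs block lab S0 S1; decide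
/-- Block `(false,false)` of `({0},{1})` has the other `13` coordinates. -/
theorem bs_ff : bs S0 S1 (false, false) = 13 := by unfold bs block lab S0 S1; decide

/-- Master count: `#{u : Φ(block weights)} = G4r 0 1 1 13 Φ`. -/
theorem count (Φ : ℕ × ℕ × ℕ × ℕ → Bool) :
    (univ.filter fun u : Fin 15 → Bool => Φ (bw4 S0 S1 u) = true).card = G4r 0 1 1 13 Φ := by
  rw [card_filter_eq_sum_box4, sum_box4_eq_G4, G4r_eq, G4q_eq, bs_tt, bs_tf, bs_ft, bs_ff]

/-- Count of one predicate that factors through the block weights. -/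
theorem count1 (A : (Fin 15 → Bool) → Bool) (a : ℕ × ℕ × ℕ × ℕ → Bool) (hA : ∀ u, A u = a (bw4 S0 S1 u)) :
    (univ.filter fun u : Fin 15 → Bool => A u = true).card = G4r 0 1 1 13 a := by
  rw [← count]
  congr 1
  exact filter_congr fun u _ => by rw [hA]

/-- Count of a conjunction of two predicates that factor through the block weights. -/
theorem count2 (A B : (Fin 15 → Bool) → Bool) (a b : ℕ × ℕ × ℕ × ℕ → Bool) (hA : ∀ u, A u = a (bw4 S0 S1 u))
    (hB : ∀ u, B u = b (bw4 S0 S1 u)) (c : Bool) :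
    (univ.filter fun u : Fin 15 → Bool => A u = true ∧ B u = c).card =
      G4r 0 1 1 13 (fun k => a k && (b k == c)) := by
  rw [← count]
  congr 1
  refine filter_congr fun u _ => ?_
  rw [hA, hB, Bool.and_eq_true, beq_iff_eq]

/-- Count of a conjunction of three predicates that factor through the block weights. -/
theorem count3 (A B C : (Fin 15 → Bool) → Bool) (a b c : ℕ × ℕ × ℕ × ℕ → Bool)
    (hA : ∀ u, A u = a (bw4 S0 S1 u)) (hB : ∀ u, B u = b (bw4 S0 S1 u)) (hC : ∀ u, C u = c (bw4 S0 S1 u)) :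
    (univ.filter fun u : Fin 15 → Bool => A u = true ∧ B u = true ∧ C u = true).card =
      G4r 0 1 1 13 (fun k => a k && b k && c k) := by
  rw [← count]
  congr 1
  refine filter_congr fun u _ => ?_
  rw [hA, hB, hC, Bool.and_eq_true, Bool.and_eq_true, and_assoc]

/-- `E` factors through the block weights (by definition). -/
theorem E_eq (u : Fin 15 → Bool) : E u = φE (bw4 S0 S1 u) := rfl

/-- `|E| = 4175`. -/
theorem cE : (univ.filter fun u : Fin 15 → Bool => E u = true).card = 4175 := by
  rw [count1 E φE E_eq]; decide +kernel

/-- `|Z| = 8736`. -/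
theorem cZ : (univ.filter fun z : Fin 15 → Bool => symWord 15 false z = false).card = 8736 :=
  failCount_symWord_fifteen

/-- `|E ∩ W0′ ∩ Out| = 3460`. -/
theorem cEY0 : (univ.filter fun u : Fin 15 → Bool => E u = true ∧ Y0 u = true ∧ symWord 15 false u = true).card
    = 3460 := by
  rw [count3 E Y0 _ φE φY0 φK E_eq Y0_eq K0_eq]; decide +kernel
/-- `|E ∩ W1′ ∩ Out| = 4175`. -/
theorem cEY1 : (univ.filter fun u : Fin 15 → Bool => E u = true ∧ Y1 u = true ∧ symWord 15 false u = true).card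
    = 4175 := by
  rw [count3 E Y1 _ φE φY1 φK E_eq Y1_eq K0_eq]; decide +kernel
/-- `|E ∩ W2′ ∩ Out| = 4175`. -/
theorem cEY2 : (univ.filter fun u : Fin 15 → Bool => E u = true ∧ Y2 u = true ∧ symWord 15 false u = true).card
    = 4175 := by
  rw [count3 E Y2 _ φE φY2 φK E_eq Y2_eq K0_eq]; decide +kernel

/-- `|W0′ ∩ Out| = 6555`. -/
theorem oc0 : MassInequality.outCount (symWord 15 false) Y0 = 6555 := by
  unfold MassInequality.outCount; rw [count2 Y0 _ φY0 φK Y0_eq K0_eq]; decide +kernel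
/-- `|W1′ ∩ Out| = 8921`. -/
theorem oc1 : MassInequality.outCount (symWord 15 false) Y1 = 8921 := by
  unfold MassInequality.outCount; rw [count2 Y1 _ φY1 φK Y1_eq K0_eq]; decide +kernel
/-- `|W2′ ∩ Out| = 8192`. -/
theorem oc2 : MassInequality.outCount (symWord 15 false) Y2 = 8192 := by
  unfold MassInequality.outCount; rw [count2 Y2 _ φY2 φK Y2_eq K0_eq]; decide +kernel
/-- `|W0′ ∩ Z| = 4368` (`= |Z₂|`). -/
theorem ic0 : MassInequality.inCount (symWord 15 false) Y0 = 4368 := by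
  unfold MassInequality.inCount; rw [count2 Y0 _ φY0 φK Y0_eq K0_eq]; decide +kernel
/-- `|W1′ ∩ Z| = 2002` (`= |Z₁ ∩ {u 0 = false}|`). -/
theorem ic1 : MassInequality.inCount (symWord 15 false) Y1 = 2002 := by
  unfold MassInequality.inCount; rw [count2 Y1 _ φY1 φK Y1_eq K0_eq]; decide +kernel
/-- `|W2′ ∩ Z| = 2366` (`= |Z₁ ∩ {u 0 = true}|`). -/
theorem ic2 : MassInequality.inCount (symWord 15 false) Y2 = 2366 := by
  unfold MassInequality.inCount; rw [count2 Y2 _ φY2 φK Y2_eq K0_eq]; decide +kernel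

/-! ### The three zero-parts are pairwise disjoint -/

/-- On `Z(K0)` at most one of `W0′, W1′, W2′` holds (a 56-case check over the realizable block weights). -/
theorem excl_box : ∀ k1 ∈ range 1, ∀ k2 ∈ range 2, ∀ k3 ∈ range 2, ∀ k4 ∈ range 14, φK (k1, k2, k3, k4) = false →
    (φY0 (k1, k2, k3, k4) = true → φY1 (k1, k2, k3, k4) = true → False) ∧
    (φY0 (k1, k2, k3, k4) = true → φY2 (k1, k2, k3, k4) = true → False) ∧
    (φY1 (k1, k2, k3, k4) = true → φY2 (k1, k2, k3, k4) = true → False) := by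
  decide

/-- On `Z(K0)` at most one of `W0′, W1′, W2′` holds. -/
theorem excl (u : Fin 15 → Bool) (hz : symWord 15 false u = false) :
    (Y0 u = true → Y1 u = true → False) ∧ (Y0 u = true → Y2 u = true → False) ∧
    (Y1 u = true → Y2 u = true → False) := by
  rw [K0_eq] at hz
  rw [Y0_eq, Y1_eq, Y2_eq]
  have hb := bw4_mem_box4 S0 S1 u
  simp only [box4, mem_product, bs_tt, bs_tf, bs_ft, bs_ff] at hb
  revert hz
  rw [show bw4 S0 S1 u = ((bw4 S0 S1 u).1, (bw4 S0 S1 u).2.1, (bw4 S0 S1 u).2.2.1, (bw4 S0 S1 u).2.2.2) from rfl]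
  exact excl_box _ hb.1 _ hb.2.1 _ hb.2.2.1 _ hb.2.2.2

/-! ### The refutation -/

/-- **`¬ (★-T⁺)(15)` at the optimum** (Sketch16 `NotTransportAllSym15`; planner qa-qnc0-p1 g14, ROUND-13 §2.14). -/
theorem notTransportAllSym15 : ¬ TransportAll 15 (symWord 15 false) := by
  intro h
  have h' := h E E_subset
  simp only [cE, cZ] at h'
  obtain ⟨n, hn⟩ := h' (by norm_num)
  unfold TransportFor at hn
  obtain ⟨hn01, hmass, hword⟩ := hn
  have h0 := hword Y0 (isElim1_cwOf _ _)
  have h1 := hword Y1 (isElim1_cwOf _ _)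
  have h2 := hword Y2 (isElim1_cwOf _ _)
  simp only [cEY0, oc0, ic0] at h0
  simp only [cEY1, oc1, ic1] at h1
  simp only [cEY2, oc2, ic2] at h2
  simp only [cE] at hmass
  have hdisj : (∑ z ∈ univ.filter (fun z : Fin 15 → Bool => symWord 15 false z = false ∧ Y0 z = true), n z) +
      (∑ z ∈ univ.filter (fun z : Fin 15 → Bool => symWord 15 false z = false ∧ Y1 z = true), n z) +
      (∑ z ∈ univ.filter (fun z : Fin 15 → Bool => symWord 15 false z = false ∧ Y2 z = true), n z) ≤
      ∑ z ∈ univ.filter (fun z : Fin 15 → Bool => symWord 15 false z = false), n z := by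
    rw [sum_filter, sum_filter, sum_filter, sum_filter, ← sum_add_distrib, ← sum_add_distrib]
    refine sum_le_sum fun u _ => ?_
    by_cases hz : symWord 15 false u = false
    · have hn := (hn01 u hz).1
      have hx := excl u hz
      simp only [hz, true_and, if_true]
      rcases Bool.eq_false_or_eq_true (Y0 u) with hY0 | hY0 <;>
      rcases Bool.eq_false_or_eq_true (Y1 u) with hY1 | hY1 <;>
      rcases Bool.eq_false_or_eq_true (Y2 u) with hY2 | hY2 <;>
      simp only [hY0, hY1, hY2, if_true, if_false, Bool.false_eq_true] <;>
      first | linarith | exact absurd (hx.1 hY0 hY1) id | exact (hx.1 hY0 hY1).elim |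
        exact (hx.2.1 hY0 hY2).elim | exact (hx.2.2 hY1 hY2).elim
    · simp [hz]
  push_cast at h0 h1 h2 hmass
  linarith

/-- **`TransportFifteen` is FALSE** (the conjecture of record of `Transport.lean`): the kernel knows that
`symWord 15 false` is a symmetric optimum of `C_15`. -/
theorem notTransportFifteen : ¬ TransportFifteen :=
  fun hT => notTransportAllSym15 (hT _ isOpt1_symWord_fifteen (isSymPat_symWord 15 false))

end TransportRefute

end Summit.QuantumAdvantage.AdviceFreeQNC0
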